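import Literature.AlgebraicGeometry.Resolution.WeightedCentreAdditiveShifts
import Literature.AlgebraicGeometry.Resolution.WeightedCentreCharacterSum
import Mathlib.Algebra.Module.RingHom
import Mathlib.Data.ZMod.Basic
import HarnessLib

/-!
# LEMMA C: the unit characters of `𝔽_p` project a fixing shift onto its `σ^r`-part, `2 ≤ r ≤ p − 1`
# (instrument for engine 1's `W(f)` toy model, NOT a resolution theorem)

Engine 1 of the RESOLUTION OBSERVATORY toy model `W(f)` (RE-DERIVATION-eng1-g41 §3.7.2 LEMMA G / LEMMA C; CARVER-NOTES-eng1-g42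
T92, the first step of THEOREM RZ).  The fixing shifts `P = (P_x)_x` off `U` of `G ∈ k[ε]` — `AdditiveShift.fixingShifts U G` of
`WeightedCentreAdditiveShifts`, an additive subgroup of `ι → k[ε][σ]` stable under the base change `σ ↦ μσ`
(`rescale_mem_fixingShifts`) — decompose by `σ`-degree, `P_x = Σ_{s=1}^{p} σ^s P_{s,x}`.  LEMMA C: for `2 ≤ r ≤ p − 1` the
`σ^r`-part `(σ^r P_{r,x})_x` is again a fixing shift.  Proof: for `μ ∈ 𝔽_pˣ ⊂ k` (`char k = p`) the element `μ^{−r}·P(μσ)` lies in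
the group (integer multiples are iterated sums), and `Σ_{μ ∈ 𝔽_pˣ} μ^{−r} P(μσ) = Σ_s σ^s P_s Σ_μ μ^{s−r} = −σ^r P_r`, because for
`2 ≤ r ≤ p − 1` the only `s ∈ {1, …, p}` with `s ≡ r (mod p − 1)` is `s = r` (`CharacterSum.zmod_sum_units_inv_pow_smul_sum_pow_smul`
of `WeightedCentreCharacterSum`).  [The residues of `1` and `p` coincide: LEMMA C says nothing about `σ P₁ + σ^p P_p` — that is
THEOREM RZ.]

* `CharacterSum.mem_of_forall_units_sum_mem` — the abstract form: an additive subgroup `𝒢` of an `R`-module, `φ : 𝔽_p → R`; if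
  `Σ_{s=1}^{p} φ(μ)^s • P s ∈ 𝒢` for every unit `μ`, then `P r ∈ 𝒢` (`2 ≤ r ≤ p − 1`) — `𝔽_p`-multiples of members are members;
* `AdditiveShift.sum_pow_smul_coeffPart` — `P(μσ) = Σ_{s=1}^{q} μ^s • σ^s P_s` for `P ∈ σ·k[ε][σ]` of `σ`-degree `≤ q`
  (`sigmaScale` of `WeightedCentreSigmaRescaling`); family form `sum_pow_smul_coeffPart_family`;
* `AdditiveShift.coeffPart_mem_fixingShifts` — **LEMMA C**: `P ∈ fixingShifts U G`, every `P_x ∈ σ·k[ε][σ]` of `σ`-degree `≤ p`,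
  `char k = p`, `2 ≤ r ≤ p − 1` ⇒ `(σ^r P_{r,x})_x ∈ fixingShifts U G`;
* `AdditiveShift.eq_X_add_X_pow_of_coeff_eq_zero` — the bookkeeping THEOREM RZ uses next: once the middle parts vanish,
  `P_x = σ P_{1,x} + σ^p P_{p,x}`.
The `σ^r`-part is then read as a LINE of translations by `WeightedCentreShiftLine` (LEMMA L's first step).

References: character sums over the cyclic group `𝔽_pˣ` [Lang2002, Ch. V §5]; the stabiliser bookkeeping [SerreLocalFields1979,
Ch. II §4 Lemma 1]; the weighted frame [AbramovichTemkinWlodarczyk2024, Thm. 5.3.1].  All statements are OURS (toy-model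
bookkeeping) — instruments for engine 1's `W(f)` model, NOT resolution theorems.
-/

namespace Literature.AlgebraicGeometry.Resolution.WeightedBlowup

open Polynomial

/-! ## The abstract projection -/

namespace CharacterSum

/-- **LEMMA C, abstract form** (ours): `𝒢` an additive subgroup of an `R`-module `M`, `φ : 𝔽_p →+* R`, `P : ℕ → M`; if
`Σ_{s=1}^{p} φ(μ)^s • P s ∈ 𝒢` for every `μ ∈ 𝔽_pˣ`, then `P r ∈ 𝒢` for `2 ≤ r ≤ p − 1` — apply `Σ_μ μ^{−r}(·)`, whose
`𝔽_p`-coefficients act through integer multiples. [cite: Lang2002, Ch. V §5] -/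
theorem mem_of_forall_units_sum_mem {p : ℕ} [Fact p.Prime] {R : Type*} [Ring R] (φ : ZMod p →+* R) {M : Type*}
    [AddCommGroup M] [Module R M] (𝒢 : AddSubgroup M) (P : ℕ → M)
    (h : ∀ μ : (ZMod p)ˣ, ∑ s ∈ Finset.Icc 1 p, (φ μ) ^ s • P s ∈ 𝒢) {r : ℕ} (hr : 2 ≤ r) (hrp : r ≤ p - 1) :
    P r ∈ 𝒢 := by
  letI : Module (ZMod p) M := Module.compHom M φ
  have hsmul : ∀ (c : ZMod p) (m : M), c • m = φ c • m := fun _ _ => rfl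
  haveI : NeZero p := ⟨(Fact.out : p.Prime).ne_zero⟩
  have hz : ∀ (c : ZMod p) {m : M}, m ∈ 𝒢 → c • m ∈ 𝒢 := fun c m hm => by
    rw [← ZMod.natCast_zmod_val c, Nat.cast_smul_eq_nsmul]
    exact 𝒢.nsmul_mem hm _
  have hmem : ∑ μ : (ZMod p)ˣ, ((μ⁻¹ : (ZMod p)ˣ) : ZMod p) ^ r • ∑ s ∈ Finset.Icc 1 p, (μ : ZMod p) ^ s • P s ∈ 𝒢 := by
    refine 𝒢.sum_mem fun μ _ => hz _ ?_
    have e : ∑ s ∈ Finset.Icc 1 p, (μ : ZMod p) ^ s • P s = ∑ s ∈ Finset.Icc 1 p, (φ μ) ^ s • P s :=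
      Finset.sum_congr rfl fun s _ => by rw [hsmul, map_pow]
    rw [e]
    exact h μ
  rw [zmod_sum_units_inv_pow_smul_sum_pow_smul p P hr hrp] at hmem
  exact neg_mem_iff.mp hmem

end CharacterSum

/-! ## LEMMA C for the fixing shifts -/

namespace AdditiveShift

variable {k : Type*} [CommRing k] {ι : Type*}

/-- `P(μσ) = Σ_{s=1}^{q} μ^s • σ^s P_s` for `P ∈ σ·k[ε][σ]` of `σ`-degree `≤ q` (ours, bookkeeping).
[cite: SerreLocalFields1979, Ch. II §4 Lemma 1] -/
theorem sum_pow_smul_coeffPart (F : (MvPolynomial ι k)[X]) {q : ℕ} (hdeg : F.natDegree ≤ q) (h0 : F.coeff 0 = 0) (c : k) :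
    ∑ s ∈ Finset.Icc 1 q, c ^ s • (C (F.coeff s) * X ^ s) = sigmaScale (MvPolynomial.C c) F := by
  refine Polynomial.ext fun n => ?_
  rw [finsetSum_coeff, coeff_sigmaScale]
  simp_rw [coeff_smul, coeff_C_mul_X_pow]
  rw [Finset.sum_eq_single n]
  · rw [if_pos rfl, MvPolynomial.smul_eq_C_mul, map_pow]
  · intro s _ hs
    rw [if_neg (Ne.symm hs), smul_zero]
  · intro hn
    have hFn : F.coeff n = 0 := by
      rw [Finset.mem_Icc, not_and_or, not_le, not_le] at hn
      rcases hn with hn | hn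
      · rw [Nat.lt_one_iff.mp hn]
        exact h0
      · exact coeff_eq_zero_of_natDegree_lt (lt_of_le_of_lt hdeg hn)
    rw [if_pos rfl, hFn, smul_zero]

/-- Family form of `sum_pow_smul_coeffPart` (ours, bookkeeping). [cite: SerreLocalFields1979, Ch. II §4 Lemma 1] -/
theorem sum_pow_smul_coeffPart_family (P : ι → (MvPolynomial ι k)[X]) {q : ℕ} (hdeg : ∀ x, (P x).natDegree ≤ q)
    (h0 : ∀ x, (P x).coeff 0 = 0) (c : k) :
    ∑ s ∈ Finset.Icc 1 q, c ^ s • (fun x => C ((P x).coeff s) * X ^ s) = fun x => sigmaScale (MvPolynomial.C c) (P x) := by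
  funext x
  rw [Finset.sum_apply]
  simp_rw [Pi.smul_apply]
  exact sum_pow_smul_coeffPart (P x) (hdeg x) (h0 x) c

/-- **LEMMA C** (ours): `char k = p`; if `P ∈ fixingShifts U G` with every `P_x ∈ σ·k[ε][σ]` of `σ`-degree `≤ p`, then for
`2 ≤ r ≤ p − 1` the `σ^r`-part `(σ^r P_{r,x})_x` is a fixing shift. [cite: Lang2002, Ch. V §5; SerreLocalFields1979, Ch. II §4 Lemma 1] -/
theorem coeffPart_mem_fixingShifts [DecidableEq ι] (p : ℕ) [Fact p.Prime] [CharP k p] {U : Set ι} {G : MvPolynomial ι k}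
    {P : ι → (MvPolynomial ι k)[X]} (hPG : P ∈ fixingShifts U G) (hdeg : ∀ x, (P x).natDegree ≤ p)
    (h0 : ∀ x, (P x).coeff 0 = 0) {r : ℕ} (hr : 2 ≤ r) (hrp : r ≤ p - 1) :
    (fun x => C ((P x).coeff r) * X ^ r) ∈ fixingShifts U G :=
  CharacterSum.mem_of_forall_units_sum_mem (ZMod.castHom (dvd_refl p) k) (fixingShifts U G)
    (fun s => fun x => C ((P x).coeff s) * X ^ s)
    (fun μ => by
      rw [sum_pow_smul_coeffPart_family P hdeg h0]
      exact rescale_mem_fixingShifts hPG _) hr hrp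

/-- Bookkeeping for THEOREM RZ (ours): if `F ∈ σ·A[σ]` has `σ`-degree `≤ q` (`q ≥ 2`) and its coefficients of `σ^r`,
`2 ≤ r ≤ q − 1`, vanish, then `F = σ F₁ + σ^q F_q`. [cite: Lang2002, Ch. IV §1] -/
theorem eq_X_add_X_pow_of_coeff_eq_zero {A : Type*} [CommRing A] (F : A[X]) {q : ℕ} (hq : 2 ≤ q) (hdeg : F.natDegree ≤ q)
    (h0 : F.coeff 0 = 0) (hmid : ∀ r, 2 ≤ r → r ≤ q - 1 → F.coeff r = 0) :
    F = C (F.coeff 1) * X + C (F.coeff q) * X ^ q := by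
  refine Polynomial.ext fun n => ?_
  rw [coeff_add, coeff_C_mul_X, coeff_C_mul_X_pow]
  by_cases h1 : n = 1
  · subst h1
    rw [if_pos rfl, if_neg (by omega), add_zero]
  by_cases hnq : n = q
  · subst hnq
    rw [if_neg h1, if_pos rfl, zero_add]
  rw [if_neg h1, if_neg hnq, add_zero]
  rcases Nat.lt_or_ge n 1 with hn | hn
  · rw [Nat.lt_one_iff.mp hn]
    exact h0
  rcases Nat.lt_or_ge q n with hn' | hn'
  · exact coeff_eq_zero_of_natDegree_lt (lt_of_le_of_lt hdeg hn')
  · exact hmid n (by omega) (by omega)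

/-! ## A worked instance -/

/-- Smoke test of the bookkeeping (ours): over `ℚ`, `σ + σ³` has `σ`-degree `3`, no constant and no `σ²` term, and indeed
`σ + σ³ = σ·1 + σ³·1`. [cite: Lang2002, Ch. IV §1] -/
example : (X + X ^ 3 : ℚ[X]) = C ((X + X ^ 3 : ℚ[X]).coeff 1) * X + C ((X + X ^ 3 : ℚ[X]).coeff 3) * X ^ 3 := by
  refine eq_X_add_X_pow_of_coeff_eq_zero _ (by norm_num) ?_ (by simp) fun r hr hr' => ?_
  · have : (X + X ^ 3 : ℚ[X]).natDegree ≤ 3 := by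
      refine (natDegree_add_le _ _).trans (max_le ?_ ?_)
      · exact natDegree_X_le.trans (by norm_num)
      · exact natDegree_X_pow_le 3
    exact this
  · obtain rfl : r = 2 := by omega
    simp [coeff_X, coeff_X_pow]

end AdditiveShift

end Literature.AlgebraicGeometry.Resolution.WeightedBlowup
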